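/-
Copyright (c) 2026 the pub-hodgecm-mathlib formalisation cell (harness21).  Prover seat hodgecm-mathlib-B-p14 (g36): road «S3-tree» (LEAD F0P3a-plan (g11), architect A-p16 (g29)),
brick T1e «VALENCIES OF THE `U(3)` LATTICE TREE», FILE V2b = THE STAR OF A SELF-DUAL VERTEX HAS `q³ + 1` VERTICES; 2026-09-01.  Sequel of ★ `UnitaryLatticeTreeRootStarOrbit` (V2a).
-/
import Literature.NumberTheory.Automorphic.UnitaryLatticeTreeRootStarOrbit             -- ★ T1e V2a (B-p14 (g36)): the star of `L₀` as residual hyperplanes `N_x`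
import Literature.NumberTheory.Automorphic.UnitaryLatticeTreeFixedStar                 -- ★ T2-E′ (F0P2-p06 (g10)): `forall_v_B₀_lt_one_iff_of_exists_unit_congr`
import Literature.NumberTheory.Automorphic.UnitaryLatticeTreeResiduallyUnipotentCorner  -- ★ S-a3 (F0P3a-p07 (g11)): `residue_eq_zero_iff_v_lt_one`, `residue_eq_of_v_sub_lt_one`
import Literature.FieldTheory.FiniteFields.QuadraticTraceKernelCount                    -- ★ `natCard_borelUnipotentParams` (`#{(a,b) : b + σb + aσa = 0} = q³`)
import HarnessLib

/-!
# The lattice graph of a hermitian space — T1e FILE V2b: A SELF-DUAL VERTEX OF THE `U(3)` TREE HAS EXACTLY `q³ + 1` NEIGHBOURS (the star of `L₀ = 𝒪³` is in bijection with the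
# isotropic points `[0:0:1]`, `[1:a:b]` (`b + σ̄b + aσ̄a = 0`) of the residual hermitian plane `(𝓀³, B̄₀)`) (Bruhat–Tits 1972 §10; Tits 1979 §3.5; Serre, *Trees* II.1.1)

Topic `NumberTheory/Automorphic`; namespace `Literature.NumberTheory.Automorphic.UnitaryLatticeTree`.  THEOREMS ONLY (no definition, no instance, no notation, no named fact,
no `sorry`); kernel lane.  Cell `pub/hodgecm-mathlib` (D-0151), crux H413 = `stmt-HodgeConjecture-24833`; road «S3-tree», brick **T1e «VALENCIES»**: the number `q³ + 1` of type-two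
neighbours of a self-dual (hyperspecial) vertex of the Bruhat–Tits tree of the unramified `U(3)`, in the currency asked by ★ `TreeDisplacementLayerCount` ED. 2 (F0P3a-p08 (g17)):
`(G.neighborSet v).Finite` and `(G.neighborSet v).ncard = q³ + 1` — NO `LocallyFinite` instance.  The type-two half (`q + 1`) is FILE V3.

THE MATHEMATICS (`K` with `Valued K ℤᵐ⁰`, `hd : UnramifiedLocalConjDatum σ ϖ`, `J₀ = antidiag(1,1,1)`, `B₀ x y = σx₀y₂ + σx₁y₁ + σx₂y₀`; the residual involution in the
cell's currency of ★ `UnitaryGroupReductionSurjective` ∕ ★ `UnitaryGroupSelfDualLocus`: `σ` preserves `𝒪` (`hσO`) and reduces to `σk : 𝓀 →+* 𝓀` (`hσk`); for the count, `|𝓀| = q²`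
and `σk y = y^q`).  By ★ V2a every vertex of the star of `L₀` is the residual hyperplane `N_x = {y ∈ 𝒪³ | B₀ x y ∈ 𝔪}` of a primitive EXACTLY isotropic integral `x`, and every
primitive residually isotropic `x` gives a vertex `N_x`.  NORMALISED REPRESENTATIVES (§2): if `|x₀| = 1` then `x = x₀·(1, A, B)` with `A = x₁∕x₀`, `B = x₂∕x₀ ∈ 𝒪` and
`B + σB + AσA = B₀ x x ∕ (x₀σx₀) = 0`; if `|x₀| < 1` then isotropy forces `|x₁| < 1`, so `|x₂| = 1` and `x ≡ x₂·e₂ (mod 𝔪)` — the isotropic points of `(𝓀³, B̄₀)` are `[0:0:1]` and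
the `[1:ā:b̄]` with `b̄ + σk b̄ + ā σk ā = 0`.  Congruent primitive vectors (`x′ ≡ c·x`, `|c| = 1`) cut out the same hyperplane (★ F0P2-p06 `forall_v_B₀_lt_one_iff_of_exists_unit_congr`),
and the hyperplanes SEPARATE the normalised representatives (§1: test vectors `(0, 1, −σA)`, `(1, 0, −σB)` ∈ `N_{(1,A,B)}` detect `Ā`, `B̄` and exclude `e₂`).  Hence (§3) the map
`Option {(ā,b̄) | b̄ + σk b̄ + ā σk ā = 0} → star(L₀)`, `∞ ↦ N_{e₂} = latt diag(ϖ,1,1)`, `(ā,b̄) ↦ N_{(1,A,B)}` (any lifts) is a BIJECTION, so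
`#star(L₀) = 1 + #{(ā,b̄)} = 1 + q³` (★ `natCard_borelUnipotentParams`: the `q³` points of the unipotent radical of the Borel of `U₃(𝔽_q)` ARE the affine isotropic points), and by
★ V1 (`ncard_neighborSet_eq_ncard_neighborSet_root`) the same holds at every self-dual vertex (§4).

* §1 `vec_mem_stdLattice`, `coe_sub_eq`, separation lemmas `residue_eq_of_forall_v_B₀_vec_iff` (two `(1,A,B)`'s with the same hyperplane have `Ā = Ā′`, `B̄ = B̄′`),
  `not_forall_v_B₀_single_iff_vec` (`N_{e₂} ≠ N_{(1,A,B)}`); `v_B₀_vec_self_lt_one` (`(1,A,B)` is residually isotropic when `B̄ + σk B̄ + Ā σk Ā = 0`).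
* §2 **`exists_unit_congr_normalForm_of_isotropic`** — the normalised representative of a primitive exactly isotropic integral vector.
* §3 **`natCard_neighborSet_root_eq`** — `Nat.card star(L₀) = Nat.card (Option {(ā,b̄) | b̄ + σk b̄ + ā σk ā = 0})` (any residue field; `σk` any reduction of `σ`).
* §4 **`finite_neighborSet_root`**, **`ncard_neighborSet_root`** (`= q³ + 1`); **`finite_neighborSet_of_isSelfDualLattice`**, **`ncard_neighborSet_of_isSelfDualLattice`** —
  THE HEADS for the T2-S fold: every self-dual vertex `v` has a finite star with `(G.neighborSet v).ncard = q ^ 3 + 1`.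

HONEST LABEL: HC_CM is proved only modulo the 2 remaining named inputs (hLiu418 24832, h413 24833) until rung 0 closes; nothing printed is asserted here (elementary lattice
algebra over a valuation ring and a finite-field count); S3 (`stub_N6nsS3id`) stays a print row until the road's END lands.

## References
* [BruhatTits1972] F. Bruhat, J. Tits, *Groupes réductifs sur un corps local I*, Publ. Math. IHÉS 41 (1972), §10 (the tree of a rank-one group; valencies from the residual groups).
* [Tits1979] J. Tits, *Reductive groups over local fields*, PSPM 33.1 (1979), §3.5 (the star of a hyperspecial vertex = the residual building: here the `q³ + 1` isotropic points
  of the Hermitian curve), §2.4 (quasi-split `U(3)`).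
* [Serre1980Trees] J.-P. Serre, *Trees* (1980), Ch. II §1.1 (neighbours of a vertex ↔ points of the projective line over the residue field; here the Hermitian curve).
* [Wilson2009] R. A. Wilson, *The Finite Simple Groups*, GTM 251 (2009), §3.6.2 (`|U| = q³` for the unipotent radical of the Borel subgroup of `U₃(q)`; `q³ + 1` isotropic points).
-/

set_option autoImplicit false

noncomputable section

open scoped Valued WithZero Matrix MatrixGroups

namespace Literature.NumberTheory.Automorphic.UnitaryLatticeTree

open Literature.NumberTheory.Automorphic Literature.NumberTheory.Automorphic.HermitianLattice
open Literature.NumberTheory.Automorphic.CartanUnique Literature.FieldTheory.FiniteFields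

variable {K : Type*} [Field K] [Valued K ℤᵐ⁰] {σ : K →+* K} {ϖ : K}

/-! ## §1 The normalised vectors `(1, A, B)` and `e₂`: integrality, isotropy, separation by test vectors -/

/-- `(1, A, B) ∈ 𝒪³` for `A, B ∈ 𝒪`. [cite: Serre1980Trees, II.1.1] -/
theorem vec_mem_stdLattice (A B : 𝒪[K]) : (![(1 : K), (A : K), (B : K)] : Fin 3 → K) ∈ stdLattice K 3 := by
  intro i
  fin_cases i
  · simp
  · simpa using (show Valued.v (A : K) ≤ 1 from A.2)
  · simpa using (show Valued.v (B : K) ≤ 1 from B.2)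

/-- The coercion `𝒪 → K` commutes with differences (bookkeeping). [cite: Serre1980Trees, II.1.1] -/
theorem coe_sub_eq (A B : 𝒪[K]) : ((A - B : 𝒪[K]) : K) = (A : K) - (B : K) := rfl

/-- **Two normalised vectors with the same residual hyperplane have the same residues**: if `N_{(1,A,B)} = N_{(1,A′,B′)}` (as the sets `{y ∈ 𝒪³ | B₀ · y ∈ 𝔪}`) then `Ā = Ā′` and
`B̄ = B̄′` — the test vectors `(0, 1, −σA)` and `(1, 0, −σB)` lie in `N_{(1,A,B)}` and pair with `(1,A′,B′)` to `σ(A′ − A)`, `σ(B′ − B)`. [cite: Serre1980Trees, II.1.1] [cite: Tits1979, §3.5] -/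
theorem residue_eq_of_forall_v_B₀_vec_iff (hvσ : ∀ a, Valued.v (σ a) = Valued.v a) {A B A' B' : 𝒪[K]}
    (h : ∀ y ∈ stdLattice K 3, (Valued.v (B₀ σ 3 ![(1 : K), (A : K), (B : K)] y) < 1 ↔ Valued.v (B₀ σ 3 ![(1 : K), (A' : K), (B' : K)] y) < 1)) :
    IsLocalRing.residue 𝒪[K] A = IsLocalRing.residue 𝒪[K] A' ∧ IsLocalRing.residue 𝒪[K] B = IsLocalRing.residue 𝒪[K] B' := by
  constructor
  · -- test vector `(0, 1, −σA)`
    have hy : (![0, 1, -σ A] : Fin 3 → K) ∈ stdLattice K 3 := by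
      intro i
      fin_cases i
      · simp
      · simp
      · simpa [hvσ] using (show Valued.v (A : K) ≤ 1 from A.2)
    have h1 : Valued.v (B₀ σ 3 ![(1 : K), (A : K), (B : K)] ![0, 1, -σ A]) < 1 := by
      have e : B₀ σ 3 ![(1 : K), (A : K), (B : K)] ![0, 1, -σ A] = 0 := by
        rw [UnitaryGroup.B₀_three_apply]; simp
      rw [e, map_zero]; exact zero_lt_one
    have h2 := (h _ hy).1 h1
    have e' : B₀ σ 3 ![(1 : K), (A' : K), (B' : K)] ![0, 1, -σ A] = σ ((A' : K) - A) := by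
      rw [UnitaryGroup.B₀_three_apply, map_sub]; simp; ring
    rw [e', hvσ] at h2
    exact (residue_eq_of_v_sub_lt_one h2).symm
  · -- test vector `(1, 0, −σB)`
    have hy : (![1, 0, -σ B] : Fin 3 → K) ∈ stdLattice K 3 := by
      intro i
      fin_cases i
      · simp
      · simp
      · simpa [hvσ] using (show Valued.v (B : K) ≤ 1 from B.2)
    have h1 : Valued.v (B₀ σ 3 ![(1 : K), (A : K), (B : K)] ![1, 0, -σ B]) < 1 := by
      have e : B₀ σ 3 ![(1 : K), (A : K), (B : K)] ![1, 0, -σ B] = 0 := by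
        rw [UnitaryGroup.B₀_three_apply]; simp
      rw [e, map_zero]; exact zero_lt_one
    have h2 := (h _ hy).1 h1
    have e' : B₀ σ 3 ![(1 : K), (A' : K), (B' : K)] ![1, 0, -σ B] = σ ((B' : K) - B) := by
      rw [UnitaryGroup.B₀_three_apply, map_sub]; simp; ring
    rw [e', hvσ] at h2
    exact (residue_eq_of_v_sub_lt_one h2).symm

/-- **`N_{e₂} ≠ N_{(1,A,B)}`**: the test vector `(1, 0, −σB)` lies in `N_{(1,A,B)}` but pairs with `e₂` to `1`. [cite: Serre1980Trees, II.1.1] [cite: Tits1979, §3.5] -/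
theorem not_forall_v_B₀_single_iff_vec (hvσ : ∀ a, Valued.v (σ a) = Valued.v a) (A B : 𝒪[K]) :
    ¬ ∀ y ∈ stdLattice K 3, (Valued.v (B₀ σ 3 (Pi.single 2 1 : Fin 3 → K) y) < 1 ↔ Valued.v (B₀ σ 3 ![(1 : K), (A : K), (B : K)] y) < 1) := by
  intro h
  have hy : (![1, 0, -σ B] : Fin 3 → K) ∈ stdLattice K 3 := by
    intro i
    fin_cases i
    · simp
    · simp
    · simpa [hvσ] using (show Valued.v (B : K) ≤ 1 from B.2)
  have h1 : Valued.v (B₀ σ 3 ![(1 : K), (A : K), (B : K)] ![1, 0, -σ B]) < 1 := by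
    have e : B₀ σ 3 ![(1 : K), (A : K), (B : K)] ![1, 0, -σ B] = 0 := by
      rw [UnitaryGroup.B₀_three_apply]; simp
    rw [e, map_zero]; exact zero_lt_one
  have h2 := (h _ hy).2 h1
  rw [B₀_single_left, show Fin.rev (2 : Fin 3) = 0 from rfl] at h2
  simp at h2

/-- **`(1, A, B)` is residually isotropic when `B̄ + σk B̄ + Ā σk Ā = 0`** (`B₀ x x = B + σB + σA·A ∈ 𝒪` reduces to that residue). [cite: Tits1979, §3.5] [cite: Wilson2009, §3.6.2] -/
theorem v_B₀_vec_self_lt_one (hσO : ∀ x : 𝒪[K], σ x ∈ 𝒪[K]) (σk : 𝓀[K] →+* 𝓀[K])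
    (hσk : ∀ x : 𝒪[K], IsLocalRing.residue 𝒪[K] ⟨σ x, hσO x⟩ = σk (IsLocalRing.residue 𝒪[K] x)) {A B : 𝒪[K]}
    (hAB : IsLocalRing.residue 𝒪[K] B + σk (IsLocalRing.residue 𝒪[K] B) + IsLocalRing.residue 𝒪[K] A * σk (IsLocalRing.residue 𝒪[K] A) = 0) :
    Valued.v (B₀ σ 3 ![(1 : K), (A : K), (B : K)] ![(1 : K), (A : K), (B : K)]) < 1 := by
  -- `B₀ x x` is the coercion of `E = B + σB + A·σA ∈ 𝒪`
  set E : 𝒪[K] := B + ⟨σ B, hσO B⟩ + A * ⟨σ A, hσO A⟩ with hE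
  have hcoe : B₀ σ 3 ![(1 : K), (A : K), (B : K)] ![(1 : K), (A : K), (B : K)] = (E : K) := by
    rw [UnitaryGroup.B₀_three_apply, hE]; simp; ring
  rw [hcoe, ← residue_eq_zero_iff_v_lt_one, hE, map_add, map_add, map_mul, hσk, hσk]
  exact hAB

/-! ## §2 The normalised representative of a primitive isotropic integral vector -/

/-- **NORMAL FORM OF AN ISOTROPIC POINT.**  Let `x ∈ 𝒪³` be primitive and exactly isotropic (`B₀ x x = 0`), and let `lift` be any section of the residue map.  Then EITHER `|x₀| < 1`,
and `x ≡ x₂·e₂ (mod 𝔪)` with `|x₂| = 1` (isotropy forces `|x₁| < 1`), OR `|x₀| = 1`, and with `A = x₁∕x₀`, `B = x₂∕x₀` one has `B + σB + AσA = 0`, so the residue pair `(Ā, B̄)`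
satisfies `B̄ + σk B̄ + Ā σk Ā = 0` and `x ≡ x₀·(1, lift Ā, lift B̄) (mod 𝔪)`. [cite: Tits1979, §3.5] [cite: Serre1980Trees, II.1.1] [cite: Wilson2009, §3.6.2] -/
theorem exists_unit_congr_normalForm_of_isotropic (hd : UnramifiedLocalConjDatum σ ϖ) (hσO : ∀ x : 𝒪[K], σ x ∈ 𝒪[K]) (σk : 𝓀[K] →+* 𝓀[K])
    (hσk : ∀ x : 𝒪[K], IsLocalRing.residue 𝒪[K] ⟨σ x, hσO x⟩ = σk (IsLocalRing.residue 𝒪[K] x))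
    (lift : 𝓀[K] → 𝒪[K]) (hlift : ∀ a, IsLocalRing.residue 𝒪[K] (lift a) = a)
    {x : Fin 3 → K} (hx : x ∈ stdLattice K 3) (hunit : ∃ j, Valued.v (x j) = 1) (hiso : B₀ σ 3 x x = 0) :
    (∃ c : K, Valued.v c = 1 ∧ ∀ i, Valued.v (x i - c * (Pi.single 2 1 : Fin 3 → K) i) < 1) ∨
      ∃ p : {p : 𝓀[K] × 𝓀[K] // p.2 + σk p.2 + p.1 * σk p.1 = 0}, ∃ c : K, Valued.v c = 1 ∧
        ∀ i, Valued.v (x i - c * (![(1 : K), (lift p.1.1 : K), (lift p.1.2 : K)] : Fin 3 → K) i) < 1 := by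
  have h0 : Valued.v (0 : K) < 1 := by rw [map_zero]; exact zero_lt_one
  by_cases hx0 : Valued.v (x 0) = 1
  · -- `|x₀| = 1`: `x = x₀ · (1, A, B)`
    right
    have hx0' : x 0 ≠ 0 := fun h => by rw [h, map_zero] at hx0; exact zero_ne_one hx0
    have hσx0 : σ (x 0) ≠ 0 := (map_ne_zero σ).2 hx0'
    have hA : Valued.v (x 1 / x 0) ≤ 1 := by rw [map_div₀, hx0, div_one]; exact hx 1
    have hB : Valued.v (x 2 / x 0) ≤ 1 := by rw [map_div₀, hx0, div_one]; exact hx 2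
    set A : 𝒪[K] := ⟨x 1 / x 0, hA⟩ with hAdef
    set B : 𝒪[K] := ⟨x 2 / x 0, hB⟩ with hBdef
    -- exact isotropy in the normalised coordinates
    have hEq : (B : K) + σ (B : K) + (A : K) * σ (A : K) = 0 := by
      have hiso' : σ (x 0) * x 2 + σ (x 1) * x 1 + σ (x 2) * x 0 = 0 := by rw [← UnitaryGroup.B₀_three_apply]; exact hiso
      change x 2 / x 0 + σ (x 2 / x 0) + x 1 / x 0 * σ (x 1 / x 0) = 0
      rw [map_div₀, map_div₀]
      field_simp
      linear_combination hiso'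
    -- the residue pair
    have hE0 : (B + ⟨σ (B : K), hσO B⟩ + A * ⟨σ (A : K), hσO A⟩ : 𝒪[K]) = 0 := Subtype.ext (by simpa using hEq)
    have hres : IsLocalRing.residue 𝒪[K] B + σk (IsLocalRing.residue 𝒪[K] B) + IsLocalRing.residue 𝒪[K] A * σk (IsLocalRing.residue 𝒪[K] A) = 0 := by
      rw [← hσk, ← hσk, ← map_mul, ← map_add, ← map_add, hE0, map_zero]
    refine ⟨⟨(IsLocalRing.residue 𝒪[K] A, IsLocalRing.residue 𝒪[K] B), hres⟩, x 0, hx0, fun i => ?_⟩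
    -- the congruence `x ≡ x₀ · (1, lift Ā, lift B̄)`
    have hcongr : ∀ (C : 𝒪[K]), Valued.v ((C : K) - (lift (IsLocalRing.residue 𝒪[K] C) : K)) < 1 := fun C => by
      rw [← coe_sub_eq, ← residue_eq_zero_iff_v_lt_one, map_sub, hlift, sub_self]
    fin_cases i
    · simp
    · have e : x 1 - x 0 * (lift (IsLocalRing.residue 𝒪[K] A) : K) = x 0 * ((A : K) - (lift (IsLocalRing.residue 𝒪[K] A) : K)) := by
        change x 1 - x 0 * _ = x 0 * (x 1 / x 0 - _)
        field_simp
      simp only [Fin.mk_one, Matrix.cons_val_one, Matrix.cons_val_zero]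
      rw [e, map_mul, hx0, one_mul]
      exact hcongr A
    · have e : x 2 - x 0 * (lift (IsLocalRing.residue 𝒪[K] B) : K) = x 0 * ((B : K) - (lift (IsLocalRing.residue 𝒪[K] B) : K)) := by
        change x 2 - x 0 * _ = x 0 * (x 2 / x 0 - _)
        field_simp
      simp only [Fin.reduceFinMk, Matrix.cons_val_two, Matrix.tail_cons, Matrix.head_cons]
      rw [e, map_mul, hx0, one_mul]
      exact hcongr B
  · -- `|x₀| < 1`: isotropy forces `|x₁| < 1`, so `|x₂| = 1` and `x ≡ x₂ · e₂`
    left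
    have hx0lt : Valued.v (x 0) < 1 := lt_of_le_of_ne (hx 0) hx0
    have hx1 : Valued.v (x 1) < 1 := by
      have h : σ (x 1) * x 1 = -(σ (x 0) * x 2 + σ (x 2) * x 0) := by
        rw [UnitaryGroup.B₀_three_apply] at hiso
        linear_combination hiso
      have hv : Valued.v (σ (x 1) * x 1) < 1 := by
        rw [h, Valuation.map_neg]
        refine (Valuation.map_add _ _ _).trans_lt (max_lt ?_ ?_)
        · rw [map_mul, hd.vσ]
          calc Valued.v (x 0) * Valued.v (x 2) ≤ Valued.v (x 0) * 1 := mul_le_mul_right (hx 2) _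
            _ < 1 := by rw [mul_one]; exact hx0lt
        · rw [map_mul, hd.vσ]
          calc Valued.v (x 2) * Valued.v (x 0) ≤ 1 * Valued.v (x 0) := mul_le_mul_left (hx 2) _
            _ < 1 := by rw [one_mul]; exact hx0lt
      rw [map_mul, hd.vσ] at hv
      by_contra hge
      have h1 : Valued.v (x 1) = 1 := le_antisymm (hx 1) (not_lt.1 hge)
      rw [h1, mul_one] at hv
      exact lt_irrefl _ hv
    have hx2 : Valued.v (x 2) = 1 := by
      obtain ⟨j, hj⟩ := hunit
      fin_cases j
      · exact absurd hj hx0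
      · exact absurd hj hx1.ne
      · exact hj
    refine ⟨x 2, hx2, fun i => ?_⟩
    fin_cases i
    · simpa using hx0lt
    · simpa using hx1
    · simp

/-! ## §3 The bijection with the normalised residual parameters -/

/-- **THE STAR OF THE ROOT ↔ THE ISOTROPIC POINTS OF `(𝓀³, B̄₀)`, NORMALISED**: `#star(L₀) = #(Option {(ā, b̄) ∈ 𝓀² | b̄ + σk b̄ + ā σk ā = 0})` — the point at infinity `[0:0:1]`
(the neighbour `N_{e₂}`) and the affine isotropic points `[1:ā:b̄]` (the neighbours `N_{(1,A,B)}`).  Valid for ANY residue field and any reduction `σk` of `σ`.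
[cite: BruhatTits1972, §10] [cite: Tits1979, §3.5] [cite: Serre1980Trees, II.1.1] -/
theorem natCard_neighborSet_root_eq (hd : UnramifiedLocalConjDatum σ ϖ) (hσO : ∀ x : 𝒪[K], σ x ∈ 𝒪[K]) (σk : 𝓀[K] →+* 𝓀[K])
    (hσk : ∀ x : 𝒪[K], IsLocalRing.residue 𝒪[K] ⟨σ x, hσO x⟩ = σk (IsLocalRing.residue 𝒪[K] x)) :
    Nat.card ((latticeGraph σ ϖ ((StdForm.antidiagonal 3).over K)).neighborSet ⟨stdLattice K 3, 0, isSelfDualLattice_stdLattice_three hd⟩) =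
      Nat.card (Option {p : 𝓀[K] × 𝓀[K] // p.2 + σk p.2 + p.1 * σk p.1 = 0}) := by
  classical
  -- a section of the residue map and the normalised vectors
  obtain ⟨lift, hlift⟩ : ∃ lift : 𝓀[K] → 𝒪[K], ∀ a, IsLocalRing.residue 𝒪[K] (lift a) = a :=
    ⟨Function.surjInv IsLocalRing.residue_surjective, Function.surjInv_eq IsLocalRing.residue_surjective⟩
  let xOf : Option {p : 𝓀[K] × 𝓀[K] // p.2 + σk p.2 + p.1 * σk p.1 = 0} → (Fin 3 → K) := fun p =>
    p.elim (Pi.single 2 1) fun q => ![(1 : K), (lift q.1.1 : K), (lift q.1.2 : K)]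
  have hxOf_none : xOf none = Pi.single 2 1 := rfl
  have hxOf_some : ∀ q, xOf (some q) = ![(1 : K), (lift q.1.1 : K), (lift q.1.2 : K)] := fun _ => rfl
  have hxL : ∀ p, xOf p ∈ stdLattice K 3 := by
    rintro (_ | q)
    · rw [hxOf_none]; exact single_mem_stdLattice 2
    · rw [hxOf_some]; exact vec_mem_stdLattice _ _
  have hxu : ∀ p, ∃ j, Valued.v (xOf p j) = 1 := by
    rintro (_ | q)
    · exact ⟨2, by rw [hxOf_none]; simp⟩
    · exact ⟨0, by rw [hxOf_some]; simp⟩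
  have hxiso : ∀ p, Valued.v (B₀ σ 3 (xOf p) (xOf p)) < 1 := by
    rintro (_ | q)
    · rw [hxOf_none, B₀_single_left, show Fin.rev (2 : Fin 3) = 0 from rfl]; simp
    · rw [hxOf_some]
      refine v_B₀_vec_self_lt_one hσO σk hσk ?_
      rw [hlift, hlift]; exact q.2
  -- the vertices `N_{x_p}`
  choose f hf using fun p => exists_mem_neighborSet_root_forall_mem_iff hd (hxL p) (hxu p) (hxiso p)
  -- hyperplane membership of `𝒪³`-vectors, read off `f`
  have hfiff : ∀ p, ∀ y ∈ stdLattice K 3, (y ∈ (f p).1 ↔ Valued.v (B₀ σ 3 (xOf p) y) < 1) := fun p y hy => by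
    rw [(hf p).2 y]; exact ⟨fun h => h.2, fun h => ⟨hy, h⟩⟩
  refine (Nat.card_congr (Equiv.ofBijective (fun p => (⟨f p, (hf p).1⟩ :
    (latticeGraph σ ϖ ((StdForm.antidiagonal 3).over K)).neighborSet ⟨stdLattice K 3, 0, isSelfDualLattice_stdLattice_three hd⟩)) ⟨?_, ?_⟩)).symm
  · -- injective: equal hyperplanes ⇒ equal normalised parameters
    intro p p' hpp'
    have hEq : f p = f p' := congrArg Subtype.val hpp'
    have hiff : ∀ y ∈ stdLattice K 3, (Valued.v (B₀ σ 3 (xOf p) y) < 1 ↔ Valued.v (B₀ σ 3 (xOf p') y) < 1) := fun y hy => by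
      rw [← hfiff p y hy, ← hfiff p' y hy, hEq]
    rcases p with _ | ⟨⟨a, b⟩, hab⟩ <;> rcases p' with _ | ⟨⟨a', b'⟩, hab'⟩
    · rfl
    · exact absurd hiff (by rw [hxOf_none, hxOf_some]; exact not_forall_v_B₀_single_iff_vec hd.vσ _ _)
    · refine absurd (fun y hy => (hiff y hy).symm) ?_
      rw [hxOf_none, hxOf_some]; exact not_forall_v_B₀_single_iff_vec hd.vσ _ _
    · rw [hxOf_some, hxOf_some] at hiff
      obtain ⟨ha, hb⟩ := residue_eq_of_forall_v_B₀_vec_iff hd.vσ hiff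
      simp only [hlift] at ha hb
      subst ha hb
      rfl
  · -- surjective: every vertex of the star is the hyperplane of a normalised vector
    rintro ⟨w, hw⟩
    obtain ⟨x, hx, hunit, hiso, hmem⟩ := exists_isotropic_forall_mem_iff_of_mem_neighborSet_root hd hw
    have key : ∀ p, (∃ c : K, Valued.v c = 1 ∧ ∀ i, Valued.v (x i - c * xOf p i) < 1) → f p = w := fun p hc => by
      refine eq_of_forall_mem_iff fun y => ?_
      rw [(hf p).2 y, hmem y]
      exact and_congr_right fun hy => (forall_v_B₀_lt_one_iff_of_exists_unit_congr hd.vσ hc y hy).symm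
    rcases exists_unit_congr_normalForm_of_isotropic hd hσO σk hσk lift hlift hx hunit hiso with hc | ⟨p, hc⟩
    · exact ⟨none, Subtype.ext (key none (by rw [hxOf_none]; exact hc))⟩
    · exact ⟨some p, Subtype.ext (key (some p) (by rw [hxOf_some]; exact hc))⟩

/-! ## §4 The counts: `q³ + 1` neighbours at every self-dual vertex -/

/-- **The star of the root is finite** (finite residue field; any reduction `σk` of `σ`). [cite: BruhatTits1972, §10] [cite: Serre1980Trees, II.1.1] -/
theorem finite_neighborSet_root (hd : UnramifiedLocalConjDatum σ ϖ) (hσO : ∀ x : 𝒪[K], σ x ∈ 𝒪[K]) (σk : 𝓀[K] →+* 𝓀[K])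
    (hσk : ∀ x : 𝒪[K], IsLocalRing.residue 𝒪[K] ⟨σ x, hσO x⟩ = σk (IsLocalRing.residue 𝒪[K] x)) [Finite 𝓀[K]] :
    ((latticeGraph σ ϖ ((StdForm.antidiagonal 3).over K)).neighborSet ⟨stdLattice K 3, 0, isSelfDualLattice_stdLattice_three hd⟩).Finite := by
  have h := natCard_neighborSet_root_eq hd hσO σk hσk
  rw [Finite.card_option] at h
  exact Set.finite_coe_iff.1 (Nat.finite_of_card_ne_zero (by rw [h]; exact Nat.succ_ne_zero _))

/-- **THE STAR OF THE ROOT HAS `q³ + 1` VERTICES** (`|𝓀| = q²`, `σk` the `q`-Frobenius: the `q³ + 1` points of the Hermitian curve of `(𝓀³, B̄₀)`, via ★ `natCard_borelUnipotentParams`).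
[cite: BruhatTits1972, §10] [cite: Tits1979, §3.5 and §2.4] [cite: Wilson2009, §3.6.2] -/
theorem ncard_neighborSet_root (hd : UnramifiedLocalConjDatum σ ϖ) (hσO : ∀ x : 𝒪[K], σ x ∈ 𝒪[K]) (σk : 𝓀[K] →+* 𝓀[K])
    (hσk : ∀ x : 𝒪[K], IsLocalRing.residue 𝒪[K] ⟨σ x, hσO x⟩ = σk (IsLocalRing.residue 𝒪[K] x))
    [Fintype 𝓀[K]] {q : ℕ} (hk : Fintype.card 𝓀[K] = q ^ 2) (hfrob : ∀ y, σk y = y ^ q) :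
    ((latticeGraph σ ϖ ((StdForm.antidiagonal 3).over K)).neighborSet ⟨stdLattice K 3, 0, isSelfDualLattice_stdLattice_three hd⟩).ncard = q ^ 3 + 1 := by
  rw [← Nat.card_coe_set_eq, natCard_neighborSet_root_eq hd hσO σk hσk, Finite.card_option, natCard_borelUnipotentParams hk σk hfrob]

/-- **The star of every self-dual vertex is finite** (the `hnb` of ★ `TreeDisplacementLayerCount` ED. 2 at type `0`). [cite: BruhatTits1972, §10] [cite: Serre1980Trees, II.1.1] -/
theorem finite_neighborSet_of_isSelfDualLattice (hd : UnramifiedLocalConjDatum σ ϖ) (hσO : ∀ x : 𝒪[K], σ x ∈ 𝒪[K]) (σk : 𝓀[K] →+* 𝓀[K])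
    (hσk : ∀ x : 𝒪[K], IsLocalRing.residue 𝒪[K] ⟨σ x, hσO x⟩ = σk (IsLocalRing.residue 𝒪[K] x)) [Finite 𝓀[K]]
    (v : {M : Submodule 𝒪[K] (Fin 3 → K) // IsVertex σ ϖ ((StdForm.antidiagonal 3).over K) M}) (hv : IsSelfDualLattice σ ϖ ((StdForm.antidiagonal 3).over K) v.1) :
    ((latticeGraph σ ϖ ((StdForm.antidiagonal 3).over K)).neighborSet v).Finite :=
  (finite_neighborSet_iff_root hd v hv).2 (finite_neighborSet_root hd hσO σk hσk)

/-- **EVERY SELF-DUAL VERTEX OF THE `U(3)` TREE HAS EXACTLY `q³ + 1` NEIGHBOURS** (all of type `2`) — the valency `q (c v) + 1 = q³ + 1` of ★ `TreeDisplacementLayerCount` ED. 2 ∕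
★ `TreeLayers.ncard_layer_succ_inter_type_eq` at the hyperspecial type, for the unramified `U(3)` with residue field of the quadratic extension of order `q²`.
[cite: BruhatTits1972, §10] [cite: Tits1979, §3.5 and §2.4] [cite: Serre1980Trees, II.1.1] -/
theorem ncard_neighborSet_of_isSelfDualLattice (hd : UnramifiedLocalConjDatum σ ϖ) (hσO : ∀ x : 𝒪[K], σ x ∈ 𝒪[K]) (σk : 𝓀[K] →+* 𝓀[K])
    (hσk : ∀ x : 𝒪[K], IsLocalRing.residue 𝒪[K] ⟨σ x, hσO x⟩ = σk (IsLocalRing.residue 𝒪[K] x))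
    [Fintype 𝓀[K]] {q : ℕ} (hk : Fintype.card 𝓀[K] = q ^ 2) (hfrob : ∀ y, σk y = y ^ q)
    (v : {M : Submodule 𝒪[K] (Fin 3 → K) // IsVertex σ ϖ ((StdForm.antidiagonal 3).over K) M}) (hv : IsSelfDualLattice σ ϖ ((StdForm.antidiagonal 3).over K) v.1) :
    ((latticeGraph σ ϖ ((StdForm.antidiagonal 3).over K)).neighborSet v).ncard = q ^ 3 + 1 := by
  rw [ncard_neighborSet_eq_ncard_neighborSet_root hd v hv, ncard_neighborSet_root hd hσO σk hσk hk hfrob]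

end Literature.NumberTheory.Automorphic.UnitaryLatticeTree

end
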